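import Mathlib.Analysis.Calculus.ParametricIntervalIntegral
import Mathlib.Analysis.Complex.CauchyIntegral
import Mathlib.MeasureTheory.Integral.IntervalIntegral.FundThmCalculus
import Mathlib.Topology.MetricSpace.Thickening
import HarnessLib

/-!
# Deformation of the real line into a graph: `∫_ℝ F = ∫_ℝ F(x + i g(x)) (1 + i g'(x)) dx`

Topic `Literature/Analysis/Complex` (contour integration). The simplest contour deformation with
a *variable* profile: if `F` is holomorphic on an open set `U ⊆ ℂ` containing the region swept
by the graphs `x ↦ x + iθ g(x)`, `0 ≤ θ ≤ 1`, of a compactly supported `C¹` function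
`g : ℝ → ℝ`, then

  `∫ x, (1 + i g'(x)) • F(x + i g(x)) = ∫ x, F(x)`

(`integral_graph_deformation_eq`; both sides are Bochner integrals over `ℝ`, and the identity
holds with no integrability hypothesis, the two integrands differing by a continuous compactly
supported function). This is the device by which space integrals of analytic integrands are
continued analytically in an exterior parameter — e.g. the analytic continuation in `x` of heat
or Oseen potentials `∫ K(x - w) a(w) dw` of a field `a` analytic near `x` only
(Grujić–Kukavica 1998; Bradshaw–Grujić–Kukavica 2015, where the profile is `g = |y| ψ`, `ψ` a
cut-off): the contour is pushed into the complex domain where the integrand is analytic and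
left on the real axis elsewhere.

Proof (`integral_graph_deformation_eq`): put `Φ(θ) = ∫_a^b ((1 + iθg') • F(x + iθg) - F) dx`
on an interval `[a, b]` beyond the support of `g`. Differentiating under the integral sign
(Mathlib `intervalIntegral.hasDerivAt_integral_of_dominated_loc_of_deriv_le`; the swept compact
region has a neighbourhood in `U`, so `θ` ranges over an open interval around `[0, 1]`),
`Φ'(θ) = ∫_a^b ∂ₓ[(i g(x)) • F(x + iθ g(x))] dx = 0` by the fundamental theorem of calculus,
`g(a) = g(b) = 0`; hence `Φ(1) = Φ(0) = 0`.

## Mathlib search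

Mathlib (this pin) has Cauchy–Goursat for rectangles, discs and annuli
(`Complex.integral_boundary_rect_eq_zero_of_differentiableOn`, `circleIntegral`, …) and the
invariance of circle integrals under change of centre/radius, but no deformation along graphs
or general homotopies of contours (searched `homotop`, `deform`, `graph` in
`Mathlib/Analysis/Complex`, `Mathlib/MeasureTheory/Integral`). Tree: vertical-line shifts
(`Literature/Analysis/Complex/VerticalLineShift.lean`), not graphs.

## References

* Z. Grujić, I. Kukavica, *Space analyticity for the Navier–Stokes and related equations with
  initial data in `L^p`*, J. Funct. Anal. 152 (1998) 447–466, §2 (complexified mild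
  formulation). [GrujicKukavica1998]
* Z. Bradshaw, Z. Grujić, I. Kukavica, J. Differential Equations 259 (2015), §3, (3.1) (the
  profile `y = α t ψ(x)`). [BradshawGrujicKukavica2015]
* Folklore (Cauchy's theorem for the region between `ℝ` and a graph).
-/

noncomputable section

open MeasureTheory Set Function Filter Metric intervalIntegral
open _root_.Topology
open scoped Interval
open _root_.Complex (I)

namespace Literature.Analysis.Complex

variable {E : Type*} [NormedAddCommGroup E] [NormedSpace ℂ E] [CompleteSpace E]

/-! ### The swept region has room: `θ` may range over an open interval -/

/-- If the graphs `x + iθ g(x)`, `θ ∈ [0,1]`, of a continuous compactly supported `g` lie in the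
open set `U`, then so do the graphs for `θ` in an open interval around `[0, 1]`. [folklore] -/
theorem exists_Ioo_graph_subset {U : Set ℂ} (hU : IsOpen U) {g : ℝ → ℝ} (hg : Continuous g)
    (hgc : HasCompactSupport g)
    (hsweep : ∀ x : ℝ, ∀ θ ∈ Icc (0 : ℝ) 1, ((x : ℂ) + I * ((θ * g x : ℝ) : ℂ)) ∈ U) :
    ∃ η : ℝ, 0 < η ∧ ∀ x : ℝ, ∀ θ ∈ Ioo (-η) (1 + η),
      ((x : ℂ) + I * ((θ * g x : ℝ) : ℂ)) ∈ U := by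
  -- the swept compact set and a closed thickening of it inside `U`
  set P : ℝ × ℝ → ℂ := fun q => (q.1 : ℂ) + I * ((q.2 * g q.1 : ℝ) : ℂ) with hP
  have hPc : Continuous P := by
    rw [hP]
    fun_prop
  set K : Set ℝ := tsupport g with hK
  have hKc : IsCompact K := hgc
  have hSc : IsCompact (P '' (K ×ˢ Icc (0 : ℝ) 1)) := (hKc.prod isCompact_Icc).image hPc
  have hSU : P '' (K ×ˢ Icc (0 : ℝ) 1) ⊆ U := by
    rintro _ ⟨⟨x, θ⟩, ⟨-, hθ⟩, rfl⟩
    exact hsweep x θ hθ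
  obtain ⟨δ, hδ, hδU⟩ := hSc.exists_cthickening_subset_open hU hSU
  obtain ⟨C, hC⟩ := hg.bounded_above_of_compact_support hgc
  have hC0 : 0 ≤ C := (norm_nonneg _).trans (hC 0)
  refine ⟨δ / (C + 1), by positivity, fun x θ hθ => ?_⟩
  by_cases hx : x ∈ K
  · -- clamp `θ` to `[0, 1]`; the two points are `|θ - θ'| |g x| ≤ η C < δ` apart
    set θ' : ℝ := max 0 (min θ 1) with hθ'
    have hθ'mem : θ' ∈ Icc (0 : ℝ) 1 := ⟨le_max_left _ _, max_le zero_le_one (min_le_right _ _)⟩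
    have hdiff : |θ - θ'| ≤ δ / (C + 1) := by
      rw [hθ']
      rcases le_total θ 0 with h0 | h0
      · rw [min_eq_left (h0.trans zero_le_one), max_eq_left h0, sub_zero, abs_of_nonpos h0]
        linarith [hθ.1]
      · rcases le_total θ 1 with h1 | h1
        · rw [min_eq_left h1, max_eq_right h0, sub_self, abs_zero]; positivity
        · rw [min_eq_right h1, max_eq_right zero_le_one, abs_of_nonneg (by linarith)]
          linarith [hθ.2]
    refine hδU (Metric.mem_cthickening_of_dist_le _ (P (x, θ')) _ _ ⟨(x, θ'), ⟨hx, hθ'mem⟩, rfl⟩ ?_)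
    rw [hP]
    simp only [dist_eq_norm]
    rw [show (x : ℂ) + I * ((θ * g x : ℝ) : ℂ) - ((x : ℂ) + I * ((θ' * g x : ℝ) : ℂ)) =
      I * (((θ - θ') * g x : ℝ) : ℂ) by push_cast; ring]
    rw [norm_mul, Complex.norm_I, one_mul, Complex.norm_real, Real.norm_eq_abs, abs_mul]
    calc |θ - θ'| * |g x| ≤ δ / (C + 1) * C := by
          refine mul_le_mul hdiff ?_ (abs_nonneg _) (by positivity)
          simpa [Real.norm_eq_abs] using hC x
      _ ≤ δ := by
          rw [div_mul_eq_mul_div, div_le_iff₀ (by positivity)]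
          nlinarith
  · -- off the support the point is the real point `x`
    have hgx : g x = 0 := image_eq_zero_of_notMem_tsupport hx
    have := hsweep x 0 ⟨le_rfl, zero_le_one⟩
    simpa [hgx] using this

/-! ### The deformed integrand, its `θ`-derivative and its `x`-primitive

Throughout, for `F : ℂ → E` and `g : ℝ → ℝ`:
* the deformed point is `x + iθ g(x)`;
* the integrand difference is `D(θ, x) = (1 + iθ g'(x)) • F(x + iθ g(x)) - F(x)`;
* its `θ`-derivative is
  `D'(θ, x) = (1 + iθ g'(x)) • ((i g(x)) • F'(x + iθ g(x))) + (i g'(x)) • F(x + iθ g(x))`,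
  which is also the `x`-derivative of `G(θ, x) = (i g(x)) • F(x + iθ g(x))`.
These are written out in full in each statement (no definitions are introduced). -/

section Integrand

variable {F : ℂ → E} {U : Set ℂ} {g : ℝ → ℝ}

/-- The deformed point `x + iθ g(x)` as a function of `θ` has derivative `i g(x)`. [folklore] -/
theorem hasDerivAt_graphPoint_param (g : ℝ → ℝ) (x θ : ℝ) :
    HasDerivAt (fun θ' : ℝ => (x : ℂ) + I * ((θ' * g x : ℝ) : ℂ)) (I * ((g x : ℝ) : ℂ)) θ := by
  have h1 : HasDerivAt (fun θ' : ℝ => ((θ' * g x : ℝ) : ℂ)) ((g x : ℝ) : ℂ) θ := by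
    have := ((hasDerivAt_id θ).mul_const (g x)).ofReal_comp
    simpa using this
  simpa using (h1.const_mul I).const_add (x : ℂ)

/-- The deformed point `x + iθ g(x)` as a function of `x` has derivative `1 + iθ g'(x)`.
[folklore] -/
theorem hasDerivAt_graphPoint_space (hg : Differentiable ℝ g) (θ x : ℝ) :
    HasDerivAt (fun x' : ℝ => (x' : ℂ) + I * ((θ * g x' : ℝ) : ℂ))
      (1 + I * ((θ * deriv g x : ℝ) : ℂ)) x := by
  have h1 : HasDerivAt (fun x' : ℝ => ((θ * g x' : ℝ) : ℂ)) ((θ * deriv g x : ℝ) : ℂ) x := by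
    have := (((hg x).hasDerivAt).const_mul θ).ofReal_comp
    simpa using this
  have h2 : HasDerivAt (fun x' : ℝ => (x' : ℂ)) 1 x := by
    simpa using (hasDerivAt_id x).ofReal_comp
  exact h2.add (h1.const_mul I)

/-- The scalar factor `1 + iθ g'(x)` as a function of `θ` has derivative `i g'(x)`. [folklore] -/
theorem hasDerivAt_graphScalar_param (g : ℝ → ℝ) (x θ : ℝ) :
    HasDerivAt (fun θ' : ℝ => (1 : ℂ) + I * ((θ' * deriv g x : ℝ) : ℂ))
      (I * ((deriv g x : ℝ) : ℂ)) θ := by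
  have h1 : HasDerivAt (fun θ' : ℝ => ((θ' * deriv g x : ℝ) : ℂ)) ((deriv g x : ℝ) : ℂ) θ := by
    have := ((hasDerivAt_id θ).mul_const (deriv g x)).ofReal_comp
    simpa using this
  simpa using (h1.const_mul I).const_add (1 : ℂ)

omit [NormedSpace ℂ E] [CompleteSpace E] in
/-- Continuity in `x` of `F(x + iθ g(x))` when the graph lies in the open set of holomorphy.
[folklore] -/
theorem continuous_comp_graphPoint {H : ℂ → E} (hH : ContinuousOn H U) (hg : Continuous g)
    {θ : ℝ} (hθ : ∀ x : ℝ, (x : ℂ) + I * ((θ * g x : ℝ) : ℂ) ∈ U) :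
    Continuous fun x : ℝ => H ((x : ℂ) + I * ((θ * g x : ℝ) : ℂ)) :=
  hH.comp_continuous (by fun_prop) hθ

omit [NormedSpace ℂ E] [CompleteSpace E] in
/-- Joint continuity in `(θ, x)` of `F(x + iθ g(x))` on a parameter set whose graphs lie in `U`.
[folklore] -/
theorem continuousOn_comp_graphPoint_uncurry {H : ℂ → E} (hH : ContinuousOn H U)
    (hg : Continuous g) {T : Set ℝ}
    (hT : ∀ θ ∈ T, ∀ x : ℝ, (x : ℂ) + I * ((θ * g x : ℝ) : ℂ) ∈ U) :
    ContinuousOn (fun q : ℝ × ℝ => H ((q.2 : ℂ) + I * ((q.1 * g q.2 : ℝ) : ℂ))) (T ×ˢ univ) :=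
  hH.comp (by fun_prop) fun q hq => hT q.1 hq.1 q.2

omit [CompleteSpace E] in
/-- **`θ`-derivative of the deformed integrand**: with `p = x + iθ g(x)`,
`∂_θ [(1 + iθg'(x)) • F(p) - F(x)] = (1 + iθg'(x)) • ((i g(x)) • F'(p)) + (i g'(x)) • F(p)`.
[folklore] -/
theorem hasDerivAt_graphIntegrand_param (hF : DifferentiableOn ℂ F U) (hU : IsOpen U)
    (x θ : ℝ) (hθ : (x : ℂ) + I * ((θ * g x : ℝ) : ℂ) ∈ U) :
    HasDerivAt (fun θ' : ℝ => ((1 : ℂ) + I * ((θ' * deriv g x : ℝ) : ℂ)) •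
        F ((x : ℂ) + I * ((θ' * g x : ℝ) : ℂ)) - F (x : ℂ))
      (((1 : ℂ) + I * ((θ * deriv g x : ℝ) : ℂ)) •
          ((I * ((g x : ℝ) : ℂ)) • deriv F ((x : ℂ) + I * ((θ * g x : ℝ) : ℂ))) +
        (I * ((deriv g x : ℝ) : ℂ)) • F ((x : ℂ) + I * ((θ * g x : ℝ) : ℂ))) θ := by
  have hFat : HasDerivAt F (deriv F ((x : ℂ) + I * ((θ * g x : ℝ) : ℂ)))
      ((x : ℂ) + I * ((θ * g x : ℝ) : ℂ)) :=
    (hF.differentiableAt (hU.mem_nhds hθ)).hasDerivAt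
  have hf : HasDerivAt (fun θ' : ℝ => F ((x : ℂ) + I * ((θ' * g x : ℝ) : ℂ)))
      ((I * ((g x : ℝ) : ℂ)) • deriv F ((x : ℂ) + I * ((θ * g x : ℝ) : ℂ))) θ :=
    hFat.scomp θ (hasDerivAt_graphPoint_param g x θ)
  exact ((hasDerivAt_graphScalar_param g x θ).smul hf).sub_const (F (x : ℂ))

omit [CompleteSpace E] in
/-- **`x`-derivative of the primitive**: with `p = x + iθ g(x)`,
`∂ₓ [(i g(x)) • F(p)] = (1 + iθg'(x)) • ((i g(x)) • F'(p)) + (i g'(x)) • F(p)`. [folklore] -/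
theorem hasDerivAt_graphPrimitive_space (hF : DifferentiableOn ℂ F U) (hU : IsOpen U)
    (hg : Differentiable ℝ g) (θ x : ℝ) (hθ : (x : ℂ) + I * ((θ * g x : ℝ) : ℂ) ∈ U) :
    HasDerivAt (fun x' : ℝ => (I * ((g x' : ℝ) : ℂ)) • F ((x' : ℂ) + I * ((θ * g x' : ℝ) : ℂ)))
      (((1 : ℂ) + I * ((θ * deriv g x : ℝ) : ℂ)) •
          ((I * ((g x : ℝ) : ℂ)) • deriv F ((x : ℂ) + I * ((θ * g x : ℝ) : ℂ))) +
        (I * ((deriv g x : ℝ) : ℂ)) • F ((x : ℂ) + I * ((θ * g x : ℝ) : ℂ))) x := by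
  have hFat : HasDerivAt F (deriv F ((x : ℂ) + I * ((θ * g x : ℝ) : ℂ)))
      ((x : ℂ) + I * ((θ * g x : ℝ) : ℂ)) :=
    (hF.differentiableAt (hU.mem_nhds hθ)).hasDerivAt
  have hc : HasDerivAt (fun x' : ℝ => I * ((g x' : ℝ) : ℂ)) (I * ((deriv g x : ℝ) : ℂ)) x := by
    have := ((hg x).hasDerivAt.ofReal_comp).const_mul I
    simpa using this
  have hf : HasDerivAt (fun x' : ℝ => F ((x' : ℂ) + I * ((θ * g x' : ℝ) : ℂ)))
      (((1 : ℂ) + I * ((θ * deriv g x : ℝ) : ℂ)) • deriv F ((x : ℂ) + I * ((θ * g x : ℝ) : ℂ)))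
      x :=
    hFat.scomp x (hasDerivAt_graphPoint_space hg θ x)
  have h := hc.smul hf
  rw [smul_smul] at h
  rw [smul_smul, mul_comm ((1 : ℂ) + I * ((θ * deriv g x : ℝ) : ℂ)) (I * ((g x : ℝ) : ℂ))]
  exact h

end Integrand

/-! ### The deformation theorem -/

/-- Off the support of `g` the derivative of `g` vanishes. [folklore] -/
theorem deriv_eq_zero_of_notMem_tsupport {g : ℝ → ℝ} {x : ℝ} (hx : x ∉ tsupport g) :
    deriv g x = 0 := by
  have h : g =ᶠ[𝓝 x] fun _ => 0 := notMem_tsupport_iff_eventuallyEq.1 hx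
  rw [h.deriv_eq, deriv_const]

/-- **The derivative of the deformed integral vanishes.** Let `F` be holomorphic on an open
`U`, `g ∈ C¹` with `g(a) = g(b) = 0` (`a ≤ b`), `S` a compact set of parameters whose graphs
`x + iθ g(x)`, `θ ∈ S`, lie in `U`, the real line lying in `U` as well, and `T ⊆ S` a
neighbourhood of `θ₀`. Then `θ ↦ ∫_a^b ((1 + iθg') • F(x + iθg) - F(x)) dx` has derivative `0`
at `θ₀`: differentiating under the integral sign gives `∫_a^b ∂ₓ[(i g) • F(x + iθ₀ g)] dx = 0`.
[folklore] -/
theorem hasDerivAt_intervalIntegral_graphIntegrand {F : ℂ → E} {U : Set ℂ} (hU : IsOpen U)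
    (hF : DifferentiableOn ℂ F U) {g : ℝ → ℝ} (hg : ContDiff ℝ 1 g) {a b : ℝ} (hab : a ≤ b)
    (hga : g a = 0) (hgb : g b = 0) {S T : Set ℝ} (hS : IsCompact S) (hTS : T ⊆ S) {θ₀ : ℝ}
    (hT : T ∈ 𝓝 θ₀) (hθ₀ : θ₀ ∈ T) (hreal : ∀ x : ℝ, (x : ℂ) ∈ U)
    (hsweep : ∀ θ ∈ S, ∀ x : ℝ, (x : ℂ) + I * ((θ * g x : ℝ) : ℂ) ∈ U) :
    HasDerivAt (fun θ : ℝ => ∫ x in a..b, (((1 : ℂ) + I * ((θ * deriv g x : ℝ) : ℂ)) •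
        F ((x : ℂ) + I * ((θ * g x : ℝ) : ℂ)) - F (x : ℂ))) 0 θ₀ := by
  have hgd : Differentiable ℝ g := hg.differentiable (by simp)
  have hg'c : Continuous (deriv g) := hg.continuous_deriv le_rfl
  have hgcont : Continuous g := hg.continuous
  have hFan : AnalyticOnNhd ℂ F U := hF.analyticOnNhd hU
  have hFc : ContinuousOn F U := hF.continuousOn
  have hF'c : ContinuousOn (deriv F) U := hFan.deriv.continuousOn
  have hθ₀S : θ₀ ∈ S := hTS hθ₀
  -- continuity of the pieces for `θ ∈ S`
  have hFP : ∀ θ ∈ S, Continuous fun x : ℝ => F ((x : ℂ) + I * ((θ * g x : ℝ) : ℂ)) :=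
    fun θ hθ => continuous_comp_graphPoint hFc hgcont (hsweep θ hθ)
  have hF'P : ∀ θ ∈ S, Continuous fun x : ℝ => deriv F ((x : ℂ) + I * ((θ * g x : ℝ) : ℂ)) :=
    fun θ hθ => continuous_comp_graphPoint hF'c hgcont (hsweep θ hθ)
  have hFreal : Continuous fun x : ℝ => F (x : ℂ) :=
    hFc.comp_continuous Complex.continuous_ofReal hreal
  have hsc : ∀ θ : ℝ, Continuous fun x : ℝ => (1 : ℂ) + I * ((θ * deriv g x : ℝ) : ℂ) :=
    fun θ => by fun_prop
  have hig : Continuous fun x : ℝ => I * ((g x : ℝ) : ℂ) := by fun_prop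
  have hig' : Continuous fun x : ℝ => I * ((deriv g x : ℝ) : ℂ) := by fun_prop
  have hDc : ∀ θ ∈ S, Continuous fun x : ℝ => ((1 : ℂ) + I * ((θ * deriv g x : ℝ) : ℂ)) •
      F ((x : ℂ) + I * ((θ * g x : ℝ) : ℂ)) - F (x : ℂ) :=
    fun θ hθ => ((hsc θ).smul (hFP θ hθ)).sub hFreal
  have hD'c : ∀ θ ∈ S, Continuous fun x : ℝ => ((1 : ℂ) + I * ((θ * deriv g x : ℝ) : ℂ)) •
      ((I * ((g x : ℝ) : ℂ)) • deriv F ((x : ℂ) + I * ((θ * g x : ℝ) : ℂ))) +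
      (I * ((deriv g x : ℝ) : ℂ)) • F ((x : ℂ) + I * ((θ * g x : ℝ) : ℂ)) :=
    fun θ hθ => ((hsc θ).smul (hig.smul (hF'P θ hθ))).add (hig'.smul (hFP θ hθ))
  -- a uniform bound for the derivative on `S × [a, b]`
  have hD'jc : ContinuousOn (fun q : ℝ × ℝ => ((1 : ℂ) + I * ((q.1 * deriv g q.2 : ℝ) : ℂ)) •
      ((I * ((g q.2 : ℝ) : ℂ)) • deriv F ((q.2 : ℂ) + I * ((q.1 * g q.2 : ℝ) : ℂ))) +
      (I * ((deriv g q.2 : ℝ) : ℂ)) • F ((q.2 : ℂ) + I * ((q.1 * g q.2 : ℝ) : ℂ))) (S ×ˢ univ) := by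
    have h1 := continuousOn_comp_graphPoint_uncurry hFc hgcont hsweep
    have h2 := continuousOn_comp_graphPoint_uncurry hF'c hgcont hsweep
    have h3 : Continuous fun q : ℝ × ℝ => (1 : ℂ) + I * ((q.1 * deriv g q.2 : ℝ) : ℂ) := by
      fun_prop
    have h4 : Continuous fun q : ℝ × ℝ => I * ((g q.2 : ℝ) : ℂ) := by fun_prop
    have h5 : Continuous fun q : ℝ × ℝ => I * ((deriv g q.2 : ℝ) : ℂ) := by fun_prop
    exact (h3.continuousOn.smul (h4.continuousOn.smul h2)).add (h5.continuousOn.smul h1)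
  obtain ⟨M, hM⟩ := (hS.prod isCompact_Icc).exists_bound_of_continuousOn
    (hD'jc.mono (prod_mono Subset.rfl (subset_univ (Icc a b))))
  -- differentiate under the integral sign
  have hmeas : ∀ᶠ θ in 𝓝 θ₀, AEStronglyMeasurable (fun x : ℝ =>
      ((1 : ℂ) + I * ((θ * deriv g x : ℝ) : ℂ)) • F ((x : ℂ) + I * ((θ * g x : ℝ) : ℂ)) - F (x : ℂ))
      (volume.restrict (Ι a b)) := by
    filter_upwards [hT] with θ hθ
    exact (hDc θ (hTS hθ)).aestronglyMeasurable
  have key := intervalIntegral.hasDerivAt_integral_of_dominated_loc_of_deriv_le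
    (F := fun θ x => ((1 : ℂ) + I * ((θ * deriv g x : ℝ) : ℂ)) •
      F ((x : ℂ) + I * ((θ * g x : ℝ) : ℂ)) - F (x : ℂ))
    (F' := fun θ x => ((1 : ℂ) + I * ((θ * deriv g x : ℝ) : ℂ)) •
      ((I * ((g x : ℝ) : ℂ)) • deriv F ((x : ℂ) + I * ((θ * g x : ℝ) : ℂ))) +
      (I * ((deriv g x : ℝ) : ℂ)) • F ((x : ℂ) + I * ((θ * g x : ℝ) : ℂ)))
    (bound := fun _ => M) hT hmeas ((hDc θ₀ hθ₀S).intervalIntegrable _ _)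
    ((hD'c θ₀ hθ₀S).aestronglyMeasurable)
    (Eventually.of_forall fun x hx θ hθ => hM (θ, x)
      ⟨hTS hθ, by rw [uIoc_of_le hab] at hx; exact Ioc_subset_Icc_self hx⟩)
    intervalIntegrable_const
    (Eventually.of_forall fun x _ θ hθ =>
      hasDerivAt_graphIntegrand_param hF hU x θ (hsweep θ (hTS hθ) x))
  -- the derivative is `∫_a^b ∂ₓ G = G b - G a = 0`
  have hzero : ∫ x in a..b, (((1 : ℂ) + I * ((θ₀ * deriv g x : ℝ) : ℂ)) •
      ((I * ((g x : ℝ) : ℂ)) • deriv F ((x : ℂ) + I * ((θ₀ * g x : ℝ) : ℂ))) +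
      (I * ((deriv g x : ℝ) : ℂ)) • F ((x : ℂ) + I * ((θ₀ * g x : ℝ) : ℂ))) = 0 := by
    rw [integral_eq_sub_of_hasDerivAt
      (fun x _ => hasDerivAt_graphPrimitive_space hF hU hgd θ₀ x (hsweep θ₀ hθ₀S x))
      ((hD'c θ₀ hθ₀S).intervalIntegrable _ _)]
    simp [hga, hgb]
  have h2 := key.2
  rwa [hzero] at h2

/-- **Deformation of the real line into a graph.** Let `F : ℂ → E` be holomorphic on an open
`U ⊆ ℂ`, `g : ℝ → ℝ` of class `C¹` with compact support, and assume the graphs `x + iθ g(x)`,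
`0 ≤ θ ≤ 1`, lie in `U`. Then `∫ x, (1 + i g'(x)) • F(x + i g(x)) = ∫ x, F(x)` (Bochner integrals
over `ℝ`; no integrability hypothesis). [folklore] -/
theorem integral_graph_deformation_eq {F : ℂ → E} {U : Set ℂ} (hU : IsOpen U)
    (hF : DifferentiableOn ℂ F U) {g : ℝ → ℝ} (hg : ContDiff ℝ 1 g) (hgc : HasCompactSupport g)
    (hsweep : ∀ x : ℝ, ∀ θ ∈ Icc (0 : ℝ) 1, ((x : ℂ) + I * ((θ * g x : ℝ) : ℂ)) ∈ U) :
    ∫ x : ℝ, ((1 : ℂ) + I * ((deriv g x : ℝ) : ℂ)) • F ((x : ℂ) + I * ((g x : ℝ) : ℂ)) =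
      ∫ x : ℝ, F (x : ℂ) := by
  have hgcont : Continuous g := hg.continuous
  have hg'c : Continuous (deriv g) := hg.continuous_deriv le_rfl
  obtain ⟨η, hη, hsw⟩ := exists_Ioo_graph_subset hU hgcont hgc hsweep
  have hreal : ∀ x : ℝ, (x : ℂ) ∈ U := fun x => by
    simpa using hsweep x 0 ⟨le_rfl, zero_le_one⟩
  have hFc : ContinuousOn F U := hF.continuousOn
  -- the integrand difference `D(θ, x)` vanishes off the support of `g`
  have hD0 : ∀ θ x, x ∉ tsupport g → ((1 : ℂ) + I * ((θ * deriv g x : ℝ) : ℂ)) •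
      F ((x : ℂ) + I * ((θ * g x : ℝ) : ℂ)) - F (x : ℂ) = 0 := by
    intro θ x hx
    simp only [image_eq_zero_of_notMem_tsupport hx, deriv_eq_zero_of_notMem_tsupport hx,
      mul_zero, Complex.ofReal_zero, add_zero, one_smul, sub_self]
  -- an interval `[a, b] = [-(R+1), R+1]` beyond the support
  obtain ⟨R, hR0, hR⟩ : ∃ R : ℝ, 0 < R ∧ tsupport g ⊆ Icc (-R) R := by
    obtain ⟨R, hR0, hR⟩ := hgc.isCompact.isBounded.subset_closedBall_lt 0 0
    refine ⟨R, hR0, ?_⟩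
    rwa [Real.closedBall_eq_Icc, zero_sub, zero_add] at hR
  set a : ℝ := -(R + 1) with ha
  set b : ℝ := R + 1 with hb
  have hab : a ≤ b := by rw [ha, hb]; linarith
  have hnot : ∀ x, x ∉ Ioc a b → x ∉ tsupport g := by
    intro x hx hxK
    have := hR hxK
    rw [mem_Icc] at this
    exact hx ⟨by rw [ha]; linarith [this.1], by rw [hb]; linarith [this.2]⟩
  have hga : g a = 0 :=
    image_eq_zero_of_notMem_tsupport fun h => by have := (hR h).1; rw [ha] at this; linarith
  have hgb : g b = 0 :=
    image_eq_zero_of_notMem_tsupport fun h => by have := (hR h).2; rw [hb] at this; linarith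
  -- `Φ(θ) = ∫_a^b D(θ, x) dx` has derivative `0` on `[0, 1]`, hence `Φ 1 = Φ 0 = 0`
  set S : Set ℝ := Icc (-(η / 2)) (1 + η / 2) with hS
  set T : Set ℝ := Ioo (-(η / 2)) (1 + η / 2) with hT
  have hSc : IsCompact S := isCompact_Icc
  have hTS : T ⊆ S := Ioo_subset_Icc_self
  have hSsw : ∀ θ ∈ S, ∀ x : ℝ, (x : ℂ) + I * ((θ * g x : ℝ) : ℂ) ∈ U :=
    fun θ hθ x => hsw x θ ⟨by linarith [hθ.1], by linarith [hθ.2]⟩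
  have hΦ' : ∀ θ ∈ uIcc (0 : ℝ) 1, HasDerivAt (fun θ : ℝ => ∫ x in a..b,
      (((1 : ℂ) + I * ((θ * deriv g x : ℝ) : ℂ)) • F ((x : ℂ) + I * ((θ * g x : ℝ) : ℂ)) -
        F (x : ℂ))) 0 θ := by
    intro θ hθ
    rw [uIcc_of_le zero_le_one] at hθ
    have hθT : θ ∈ T := ⟨by linarith [hθ.1], by linarith [hθ.2]⟩
    exact hasDerivAt_intervalIntegral_graphIntegrand hU hF hg hab hga hgb hSc hTS
      (isOpen_Ioo.mem_nhds hθT) hθT hreal hSsw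
  have hΦ10 := integral_eq_sub_of_hasDerivAt hΦ' intervalIntegrable_const
  simp only [intervalIntegral.integral_zero, zero_mul, Complex.ofReal_zero, mul_zero, add_zero,
    one_smul, sub_self, sub_zero] at hΦ10
  -- `hΦ10 : 0 = Φ 1`
  have hD1 : ∫ x, (((1 : ℂ) + I * ((1 * deriv g x : ℝ) : ℂ)) •
      F ((x : ℂ) + I * ((1 * g x : ℝ) : ℂ)) - F (x : ℂ)) = 0 := by
    rw [← setIntegral_eq_integral_of_forall_compl_eq_zero (s := Ioc a b)
      (fun x hx => hD0 1 x (hnot x hx)), ← intervalIntegral.integral_of_le hab]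
    exact hΦ10.symm
  simp only [one_mul] at hD1
  -- conclusion
  have hDc : Continuous fun x : ℝ => ((1 : ℂ) + I * ((deriv g x : ℝ) : ℂ)) •
      F ((x : ℂ) + I * ((g x : ℝ) : ℂ)) - F (x : ℂ) := by
    have h1 : Continuous fun x : ℝ => F ((x : ℂ) + I * ((1 * g x : ℝ) : ℂ)) :=
      continuous_comp_graphPoint hFc hgcont fun x => hsweep x 1 ⟨zero_le_one, le_rfl⟩
    simp only [one_mul] at h1
    have h2 : Continuous fun x : ℝ => F (x : ℂ) :=
      hFc.comp_continuous Complex.continuous_ofReal hreal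
    have h3 : Continuous fun x : ℝ => (1 : ℂ) + I * ((deriv g x : ℝ) : ℂ) := by fun_prop
    exact (h3.smul h1).sub h2
  have hD1i : Integrable fun x : ℝ => ((1 : ℂ) + I * ((deriv g x : ℝ) : ℂ)) •
      F ((x : ℂ) + I * ((g x : ℝ) : ℂ)) - F (x : ℂ) := by
    refine hDc.integrable_of_hasCompactSupport ?_
    refine HasCompactSupport.intro (isCompact_Icc (a := a) (b := b)) fun x hx => ?_
    have := hD0 1 x (hnot x fun h => hx (Ioc_subset_Icc_self h))
    simpa only [one_mul] using this
  have hsum : (fun x : ℝ => ((1 : ℂ) + I * ((deriv g x : ℝ) : ℂ)) •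
      F ((x : ℂ) + I * ((g x : ℝ) : ℂ))) = fun x => (((1 : ℂ) + I * ((deriv g x : ℝ) : ℂ)) •
        F ((x : ℂ) + I * ((g x : ℝ) : ℂ)) - F (x : ℂ)) + F (x : ℂ) := by
    funext x
    simp only [sub_add_cancel]
  rw [hsum]
  by_cases hFi : Integrable fun x : ℝ => F (x : ℂ)
  · rw [integral_add hD1i hFi, hD1, zero_add]
  · have hnot' : ¬ Integrable fun x : ℝ => (((1 : ℂ) + I * ((deriv g x : ℝ) : ℂ)) •
        F ((x : ℂ) + I * ((g x : ℝ) : ℂ)) - F (x : ℂ)) + F (x : ℂ) := by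
      intro h
      refine hFi ((h.sub hD1i).congr (Eventually.of_forall fun x => ?_))
      simp only [Pi.sub_apply, add_sub_cancel_left]
    rw [integral_undef hnot', integral_undef hFi]

end Literature.Analysis.Complex

end
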